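import Literature.NumberTheory.GaloisRepresentations.WeilDeligneOfGalois
import Literature.NumberTheory.GaloisRepresentations.WeilGroupFrobeniusPowers
import Literature.NumberTheory.GaloisRepresentations.WeilDeligneOfGaloisUnramifiedProofs
import Literature.NumberTheory.GaloisRepresentations.GaloisRep
import Literature.RepresentationTheory.Semisimple.BurnsideMatrixSpan
import Literature.LinearAlgebra.BaseChange.LinearIndependentFieldExtension
import Literature.LinearAlgebra.Matrix.NilpotentExpInjective
import Summits.Langlands.Langlands.Theorems.IrreducibilityBySelfDualityIrreducibleOffSectorWDIrreducibleBasics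
import HarnessLib

/-!
# L4: indecomposability of a Weil–Deligne representation descends along transport of
# coefficients and Frobenius-semisimplification
(crux stmt-Langlands-14329 `IrreducibilityBySelfDuality.IrreducibleOffSector`, supports kit
`square-integrable-place` §1; `--supports` file; STRUCTURAL: Literature imports only)

If `Wℂ = ι(W)` and a Frobenius-semisimplification `Wℂ'` of `Wℂ` is indecomposable, then `W` is
indecomposable: a decomposition `W = p ⊕ p'` into non-zero sub-Weil–Deligne representations is
transported to `ℂ` (`pℂ = span_ℂ ι(p)`, same dimension: `linearIndependent_algebraMap_comp_iff`;
complementary; `Wℂ`-stable since `[Wℂ.ρ w] = [W.ρ w].map ι`, `[Wℂ.N] = [W.N].map ι`), and the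
pieces are `Wℂ'`-stable because `Wℂ'.N = Wℂ.N` and `Wℂ'.ρ w` is the semisimple part of `Wℂ.ρ w`,
a POLYNOMIAL in `Wℂ.ρ w` (Jordan–Chevalley: Mathlib `Module.End.exists_isNilpotent_isSemisimple` +
uniqueness `Module.End.isNilpotent_isSemisimple_unique`).
Reference: Deligne, Antwerp II §8.5–8.6; Bourbaki, Algèbre VII §5 (Jordan–Chevalley).
-/

noncomputable section

set_option linter.dupNamespace false

open scoped MatrixGroups Matrix NumberField
open Module IsDedekindDomain
open Literature.NumberTheory.GaloisRepresentations
open Literature.NumberTheory.GaloisRepresentations.WeilGroup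

namespace Summit.Langlands.Langlands.Theorems.IrreducibleOffSector.SquareIntegrablePlace


/-- **L4 (descent of indecomposability along `ι` and Frobenius-semisimplification).** If `ι(W)` has an
indecomposable Frobenius-semisimplification then `W` is indecomposable.
[cite: DeligneAntwerpII1973, §8.5–8.6] -/
theorem isIndecomposable_of_transport_frobSS {F : Type} [Field F] [ValuativeRel F]
    [TopologicalSpace F] [IsNonarchimedeanLocalField F] {ℓ n : ℕ} [Fact ℓ.Prime]
    (ι : PadicAlgCl ℓ →+* ℂ) (W : WeilDeligneRep F (PadicAlgCl ℓ) (Fin n → PadicAlgCl ℓ))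
    (Wℂ Wℂ' : WeilDeligneRep F ℂ (Fin n → ℂ)) (ht : W.IsTransportAlong ι Wℂ)
    (hF : Wℂ'.IsFrobSemisimplificationOf Wℂ) (hind : Wℂ'.IsIndecomposable) : W.IsIndecomposable := by
  classical
  -- positive rank, non-triviality
  have hn : 0 < n := by
    rcases Nat.eq_zero_or_pos n with h0 | h
    · subst h0
      exact absurd hind.1 (not_nontrivial _)
    · exact h
  haveI : Nonempty (Fin n) := ⟨⟨0, hn⟩⟩
  refine ⟨inferInstance, fun p p' hp hp' hc => ?_⟩
  by_contra hne
  obtain ⟨hpne, hp'ne⟩ := not_or.mp hne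
  -- the transport map `f v = ι ∘ v` (ι-semilinear)
  letI : Algebra (PadicAlgCl ℓ) ℂ := ι.toAlgebra
  let f : (Fin n → PadicAlgCl ℓ) →ₛₗ[ι] (Fin n → ℂ) :=
    { toFun := fun v => ι ∘ v
      map_add' := fun v w => by ext i; simp
      map_smul' := fun c v => by ext i; simp }
  have hf : ∀ v, f v = ι ∘ v := fun _ => rfl
  -- compatibility with the two Weil–Deligne structures
  have hfρ : ∀ w v, Wℂ.ρ w (f v) = f (W.ρ w v) := by
    intro w v
    rw [← LinearMap.toMatrix'_mulVec (Wℂ.ρ w), ht.1 w, hf, hf]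
    ext i
    rw [← RingHom.map_mulVec, LinearMap.toMatrix'_mulVec]
    rfl
  have hfN : ∀ v, Wℂ.N (f v) = f (W.N v) := by
    intro v
    rw [← LinearMap.toMatrix'_mulVec Wℂ.N, ht.2, hf, hf]
    ext i
    rw [← RingHom.map_mulVec, LinearMap.toMatrix'_mulVec]
    rfl
  -- transport of subspaces
  let T : Submodule (PadicAlgCl ℓ) (Fin n → PadicAlgCl ℓ) → Submodule ℂ (Fin n → ℂ) :=
    fun q => Submodule.span ℂ (f '' q)
  have hT : ∀ q, T q = Submodule.span ℂ (f '' q) := fun _ => rfl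
  -- (a) stability of `T q` under a linear map compatible with a map preserving `q`
  have hstab : ∀ (q : Submodule (PadicAlgCl ℓ) (Fin n → PadicAlgCl ℓ))
      (g : (Fin n → ℂ) →ₗ[ℂ] (Fin n → ℂ)) (g₀ : (Fin n → PadicAlgCl ℓ) →ₗ[PadicAlgCl ℓ] (Fin n → PadicAlgCl ℓ)),
      (∀ v, g (f v) = f (g₀ v)) → q ≤ q.comap g₀ → T q ≤ (T q).comap g := by
    intro q g g₀ hg hq x hx
    rw [Submodule.mem_comap]
    rw [hT] at hx ⊢
    refine Submodule.span_induction (p := fun x _ => g x ∈ Submodule.span ℂ (f '' q)) ?_ ?_ ?_ ?_ hx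
    · rintro _ ⟨v, hv, rfl⟩
      rw [hg]
      exact Submodule.subset_span ⟨g₀ v, hq hv, rfl⟩
    · rw [map_zero]; exact Submodule.zero_mem _
    · intro x y _ _ hx hy
      rw [map_add]; exact Submodule.add_mem _ hx hy
    · intro a x _ hx
      rw [map_smul]; exact Submodule.smul_mem _ a hx
  have hTsub : ∀ q, W.IsSubrep q → Wℂ.IsSubrep (T q) := fun q hq =>
    ⟨fun w => hstab q (Wℂ.ρ w) (W.ρ w) (hfρ w) (hq.1 w), hstab q Wℂ.N W.N hfN hq.2⟩
  -- (b) `Wℂ'`-stability: `Wℂ'.ρ w` is a polynomial in `Wℂ.ρ w` (Jordan–Chevalley)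
  have hpoly : ∀ w, Wℂ'.ρ w ∈ Algebra.adjoin ℂ {Wℂ.ρ w} := by
    intro w
    obtain ⟨hs, nw, hnil, hcomm, heq⟩ := hF.2.2 w
    obtain ⟨n₀, hn₀, s₀, hs₀, hn₀nil, hs₀ss, h₀⟩ :=
      Module.End.exists_isNilpotent_isSemisimple (f := Wℂ.ρ w)
    have hc₀ : Commute n₀ s₀ :=
      Algebra.commute_of_mem_adjoin_singleton_of_commute hs₀
        (Algebra.commute_of_mem_adjoin_singleton_of_commute hn₀ (Commute.refl _)).symm
    have huniq := Module.End.isNilpotent_isSemisimple_unique hnil hs hn₀nil hs₀ss hcomm hc₀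
      (by rw [add_comm, ← heq, h₀])
    rw [huniq.2]
    exact hs₀
  have hT'sub : ∀ q, W.IsSubrep q → Wℂ'.IsSubrep (T q) := by
    intro q hq
    refine ⟨fun w => ?_, by rw [hF.1]; exact (hTsub q hq).2⟩
    have hρst := (hTsub q hq).1 w
    refine Algebra.adjoin_induction (p := fun g _ => T q ≤ (T q).comap g) ?_ ?_ ?_ ?_ (hpoly w)
    · intro x hx
      rw [Set.mem_singleton_iff] at hx
      rw [hx]
      exact hρst
    · intro r x hx
      rw [Submodule.mem_comap, Algebra.algebraMap_eq_smul_one, LinearMap.smul_apply,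
        Module.End.one_apply]
      exact Submodule.smul_mem _ r hx
    · intro x y _ _ hx hy v hv
      rw [Submodule.mem_comap, LinearMap.add_apply]
      exact Submodule.add_mem _ (hx hv) (hy hv)
    · intro x y _ _ hx hy v hv
      rw [Submodule.mem_comap, Module.End.mul_apply]
      exact hx (hy hv)
  -- (c) dimensions: `finrank (T q) = finrank q`
  have hdim : ∀ q : Submodule (PadicAlgCl ℓ) (Fin n → PadicAlgCl ℓ),
      Module.finrank ℂ (T q) = Module.finrank (PadicAlgCl ℓ) q := by
    intro q
    let b := Module.finBasis (PadicAlgCl ℓ) q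
    -- the transported basis vectors are linearly independent over `ℂ`
    have hli : LinearIndependent (PadicAlgCl ℓ) (fun i => ((b i : q) : Fin n → PadicAlgCl ℓ)) :=
      b.linearIndependent.map' q.subtype q.ker_subtype
    have hli' : LinearIndependent ℂ (fun i => f (b i : q)) := by
      have h := (Literature.LinearAlgebra.BaseChange.linearIndependent_algebraMap_comp_iff_of_field
        (k := PadicAlgCl ℓ) (K := ℂ) (v := fun i => ((b i : q) : Fin n → PadicAlgCl ℓ))).mpr hli
      exact h
    -- and they span `T q`
    have hspan : Submodule.span ℂ (Set.range fun i => f (b i : q)) = T q := by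
      apply le_antisymm
      · refine Submodule.span_le.mpr ?_
        rintro _ ⟨i, rfl⟩
        exact Submodule.subset_span ⟨(b i : q), (b i).2, rfl⟩
      · rw [hT]
        refine Submodule.span_le.mpr ?_
        rintro _ ⟨v, hv, rfl⟩
        rw [SetLike.mem_coe]
        have hxb : (⟨v, hv⟩ : q) ∈ Submodule.span (PadicAlgCl ℓ) (Set.range b) := by
          rw [b.span_eq]; exact Submodule.mem_top
        have key : ∀ x : q, x ∈ Submodule.span (PadicAlgCl ℓ) (Set.range b) →
            f (x : Fin n → PadicAlgCl ℓ) ∈ Submodule.span ℂ (Set.range fun i => f (b i : q)) := by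
          intro x hx
          refine Submodule.span_induction
            (p := fun (x : q) _ => f (x : Fin n → PadicAlgCl ℓ) ∈
              Submodule.span ℂ (Set.range fun i => f (b i : q))) ?_ ?_ ?_ ?_ hx
          · rintro _ ⟨i, rfl⟩
            exact Submodule.subset_span ⟨i, rfl⟩
          · simp
          · intro x y _ _ hx hy
            rw [Submodule.coe_add, map_add]
            exact Submodule.add_mem _ hx hy
          · intro c x _ hx
            rw [Submodule.coe_smul, LinearMap.map_smulₛₗ]
            exact Submodule.smul_mem _ _ hx
        exact key ⟨v, hv⟩ hxb
    rw [← hspan, finrank_span_eq_card hli', Fintype.card_fin]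
  -- (d) `T p ⊔ T p' = ⊤`
  have hsup : T p ⊔ T p' = ⊤ := by
    rw [eq_top_iff, ← (Pi.basisFun ℂ (Fin n)).span_eq, Submodule.span_le]
    rintro _ ⟨i, rfl⟩
    have hi : (Pi.basisFun ℂ (Fin n) i : Fin n → ℂ) = f (Pi.single i 1) := by
      ext j
      simp [hf, Pi.single_apply, apply_ite ι]
    have hmem : (Pi.single i 1 : Fin n → PadicAlgCl ℓ) ∈ p ⊔ p' := by
      rw [hc.codisjoint.eq_top]; exact Submodule.mem_top
    obtain ⟨y, hy, z, hz, hyz⟩ := Submodule.mem_sup.mp hmem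
    rw [SetLike.mem_coe, hi, ← hyz, map_add]
    exact Submodule.add_mem_sup (Submodule.subset_span ⟨y, hy, rfl⟩)
      (Submodule.subset_span ⟨z, hz, rfl⟩)
  -- (e) disjointness by a dimension count
  have hfin : Module.finrank ℂ (T p) + Module.finrank ℂ (T p') = n := by
    rw [hdim, hdim, Submodule.finrank_add_eq_of_isCompl hc, Module.finrank_fin_fun]
  have hinf : T p ⊓ T p' = ⊥ := by
    have h := Submodule.finrank_sup_add_finrank_inf_eq (T p) (T p')
    rw [hsup, finrank_top, Module.finrank_fin_fun, hfin, add_eq_left] at h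
    exact Submodule.finrank_eq_zero.mp h
  have hcT : IsCompl (T p) (T p') := ⟨disjoint_iff.mpr hinf, codisjoint_iff.mpr hsup⟩
  -- (f) both transported pieces are non-zero: contradiction with indecomposability of `Wℂ'`
  have hne : ∀ q : Submodule (PadicAlgCl ℓ) (Fin n → PadicAlgCl ℓ), q ≠ ⊥ → T q ≠ ⊥ := by
    intro q hq hTq
    apply hq
    rw [← Submodule.finrank_eq_zero] at hTq ⊢
    rw [← hdim, hTq]
  rcases hind.2 (T p) (T p') (hT'sub p hp) (hT'sub p' hp') hcT with h | h
  · exact hne p hpne h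
  · exact hne p' hp'ne h

end Summit.Langlands.Langlands.Theorems.IrreducibleOffSector.SquareIntegrablePlace

end
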